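import Mathlib
import Summits.KontsevichZagierPeriods.Zeta5Search.Elimination.LatticeCriterion
import Summits.KontsevichZagierPeriods.Zeta5Search.WedgeDictionary
import HarnessLib

/-!
# Lattice (Siegel-type) elimination of `ζ(3)` on the Brown–Zudilin record ray — the OPEN hypothesis, typed

systematic search; no irrationality claim unless certified.

Cell `pub-zeta5`, class `elim` (two-family combinations eliminating `ζ(3)`), `FAMILY.md` §15 (gen-3, v3.2; this file v4).  This
file contains NO cited fact and NO claim: it TYPES the single open hypothesis of the lattice road of §15 on one
concrete module — the three members

  `F₇(b(n))`, `F₇(b(n) + e₁)`, `F₇(b(n) + e₀)`,   `b(n) = n·(41; 17,16,15,14,13,12,11)`   (`n ≥ 1`)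

of Brown–Zudilin's record family in THEIR gauge `F₇ = (35)·F̃₇` (arXiv:2210.03391, (34)–(35); tree: `vwpDual 7`,
`F7`, decomposition `WedgeDictionary.vwpDual_seven_eq_of_region` with coefficients `coeffU`, `coeffW`, `coeffV`) —
and proves that it implies `Irrational (zetaValue 5)` through the assembled criterion
`Elimination.irrational_of_lattice_elimination` (`LatticeCriterion.lean`).

* `recTriple n i` — the three parameter vectors; `recTriple_region`, `recTriple_decomp` — they lie in the region of
  the decomposition theorem for `n ≥ 1`; `bzPref`, `F7_eq_bzPref_mul`, `F7_recTriple_eq` — the gauge factor (35)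
  and `F₇(bᵢ) = u ζ(5) + w ζ(3) + v` member by member with `(u, w, v) = (35)·(U, W, −V)` (PROVED, no hypothesis).
* `LatticeBalanceRecord` (`@[conjecture]`, OPEN) — for every `q ≥ 1` some index `n ≥ 1` at which the coefficient
  triple has rank 3 and the lattice `M_n = {α ∈ ℤ³ : α ⊥ (w(bᵢ))ᵢ, α·(u(bᵢ))ᵢ ∈ ℤ, α·(v(bᵢ))ᵢ ∈ ℤ}` contains two
  linearly independent vectors OF HEIGHT `≤ e^{55 n}` whose eliminated forms `Σ αᵢ F₇(bᵢ)` are `< 1/q`.  TWO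
  REMARKS THAT DETERMINE THE SHAPE: (1) the HEIGHT BOUND is what gives the statement content — `α ↦ (α·u, α·v)`
  embeds `M_n` into `ℤ²` with finite index and the eliminated form of `α` is `A ζ(5) + B` for its image pair, so the
  height-free statement follows from `ζ(5) ∉ ℚ` by scaling Dirichlet pairs by the index and is EQUIVALENT to
  irrationality (given rank 3); with the bound it asserts that the explicit lattices `M_n` have BOTH successive minima
  at height `≤ e^{55 n}` with decaying forms ('balance'; Dirichlet pull-backs sit at height `≈ e^{135 n}`); (2) the
  lattice is GAUGE-dependent (members `pᵢ·F(bᵢ)` give relations `diag(pᵢ)α`); the statement is in Brown–Zudilin's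
  gauge `F₇`, in which the successive-minima rates are stationary in `n` (in the canonical gauge `F̃₇` they drift like
  `log n` because (35) is super-exponential along rays, so no bound `e^{T n}` would be right there).  MEASURED (exact
  rational arithmetic, `HOME/pub-zeta5-fam-elim/g3/lattice_*.json`, `FAMILY.md` §15.4 / §15.8): gauge `F₇`, record
  ray, `n ≤ 22`, three triples: rank 3 everywhere; `λ₂`-rate `51.4 … 53.2` and `λ₁`-rate `≥ 51.4` nats/step for
  `6 ≤ n ≤ 22` (balance `log λ₁ / log λ₂ ≥ 0.992` for `n ≥ 7`); eliminated forms of both minima `≈ e^{−(33.5 ± 2) n}`;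
  needed for decay only `λ₁`-rate `> τ* = 18.8`.  The hypothesis is that this persists for infinitely many `n`.  It is
  implied by the balance hypothesis `H(τ*)` of §15.3 together with the (unproved) decay and covolume rates, it implies
  `ζ(5) ∉ ℚ` (theorem below), and NO technique to prove it is known (Fischler, arXiv:2109.10136, Remark 1: Siegel's
  lemma applied to eliminate among explicit forms yields nothing explicit).
* `irrational_zetaFive_of_latticeBalanceRecord : LatticeBalanceRecord → Irrational (zetaValue 5)` — the
  reduction, kernel-checked (it discards the height bounds: the arithmetic content of the hypothesis lies in them, the
  Diophantine consequence does not need them).  A CONDITIONAL statement whose hypothesis is open; it certifies the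
  ROAD, not the result.
* STATUS (v4; `FAMILY.md` §15.9 and `Elimination/LatticeSandwich.lean`): THE HYPOTHESIS IS DOWNSTREAM OF THE GOAL —
  the road is CLOSED, precisely.  `LatticeSandwich.no_short_relation_of_measure` (kernel-checked, elementary) shows
  that a nonzero relation `α ∈ M_n` of height `≤ e^{τ n}` yields an integer approximation `|ζ(5) − P/Q| ≤ Q^{−κ}`,
  `κ = 1 + (c − τ)/(τ + u⊥)`, `Q ≤ e^{(τ + u⊥) n}`, where `u⊥ = 30.3` is the measured ALIGNMENT rate of the `ζ(5)`-
  against the `ζ(3)`-coefficient vector over the three members (`‖u⃗‖` itself grows at `65`) and `c = 86.2` the decay;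
  at the weakest useful scale `τ* = 18.8` (§15.3) this is `κ* = 2.37`, so
  `[Irrational ζ(5) ∧ μ(ζ(5)) < 2.37] ⟹ H(τ*) for all large n ⟹ Irrational ζ(5)`.
  The present statement (both minima below `e^{55 n}`) is stronger than `H(τ*)`; its failure at level `n` forces an
  approximation of `ζ(5)` with `Q ≤ e^{80 n}`, `|ζ(5) − P/Q| ≤ Q^{−1.45}` lying IN the explicit index-`e^{48 n}`
  sublattice `P_n = (α·u, α·v)(M_n) ⊂ ℤ²` — Dirichlet-trivial in `ℤ²`, generically absent from `P_n` (room `≈ e^{5 n}`).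
  Either way it is a Diophantine property OF `ζ(5)` (no conspiracy between its good approximations and `P_n`), not a
  property of the hypergeometric construction that could be proved independently: every proof must first exclude
  `ζ(5) = p/q`, for which `I_n·(q, −p) ∈ P_n` has eliminated form exactly `0`.  The observed 'margins' of §15.4
  (`+33.5` record, `+2.0` at `1⁸`) equal `log(pair size / index of P_n)` per step and are forced for any reduced basis
  of a planar lattice (pigeonhole quality) — consistent with irrationality, no evidence beyond it.  This node is
  therefore DOCUMENTATION OF A CLOSED ROAD: optional to file, never to be staffed.
-/


namespace Summit.KontsevichZagierPeriods.Zeta5Search.Elimination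

open Finset
open Literature.NumberTheory.Transcendental (zetaValue)
open Literature.NumberTheory.Irrationality.BrownZudilin2022 (vwpDual F7 zfact)
open Summit.KontsevichZagierPeriods.Zeta5Search.WedgeDictionary (coeffU coeffW coeffV vwpDual_seven_eq_of_region)

/-! ### The three members of the record module -/

/-- Brown–Zudilin's record direction in `b`-coordinates, `(41; 17,16,15,14,13,12,11)`, as a function `ℕ → ℤ`
(zero beyond index 7). -/
def recDir : ℕ → ℤ
  | 0 => 41
  | 1 => 17
  | 2 => 16
  | 3 => 15
  | 4 => 14
  | 5 => 13
  | 6 => 12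
  | 7 => 11
  | _ => 0

/-- The three shifts `0`, `e₁`, `e₀` selecting the members of the module. -/
def recShift (i : Fin 3) (j : ℕ) : ℤ :=
  if i.val = 1 ∧ j = 1 then 1 else if i.val = 2 ∧ j = 0 then 1 else 0

/-- The `i`-th member at step `n`: `b = n·recDir + recShift i` (`i = 0`: the ray itself; `i = 1`: `+e₁`;
`i = 2`: `+e₀`). -/
def recTriple (n : ℕ) (i : Fin 3) (j : ℕ) : ℤ := (n : ℤ) * recDir j + recShift i j

/-- For `n ≥ 1` every member lies in the region of the decomposition theorem:
`0 ≤ b₀`, `0 ≤ 2b_j ≤ b₀ + 1` (`1 ≤ j ≤ 7`), `Σ_j b_j ≤ 3b₀ + 1` (linear inequalities in `n`, case by case). -/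
theorem recTriple_region (n : ℕ) (hn : 1 ≤ n) (i : Fin 3) :
    0 ≤ recTriple n i 0 ∧
    (∀ j ∈ range 7, 0 ≤ recTriple n i (j + 1) ∧ 2 * recTriple n i (j + 1) ≤ recTriple n i 0 + 1) ∧
    ∑ j ∈ range 7, recTriple n i (j + 1) ≤ 3 * recTriple n i 0 + 1 := by
  have hn' : (1 : ℤ) ≤ n := by exact_mod_cast hn
  fin_cases i
  all_goals
    refine ⟨?_, ?_, ?_⟩
    · simp [recTriple, recDir, recShift] <;> omega
    · intro j hj
      have hj' : j < 7 := mem_range.1 hj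
      interval_cases j <;> simp [recTriple, recDir, recShift] <;> omega
    · simp [sum_range_succ, recTriple, recDir, recShift]
      omega

/-- DECOMPOSITION, member by member (PROVED): for `n ≥ 1`,
`F̃₇(recTriple n i) = U·ζ(5) + W·ζ(3) − V` with the canonical coefficients of `WedgeDictionary`. -/
theorem recTriple_decomp (n : ℕ) (hn : 1 ≤ n) (i : Fin 3) :
    vwpDual 7 (recTriple n i) =
      (coeffU (recTriple n i) : ℝ) * zetaValue 5 + (coeffW (recTriple n i) : ℝ) * zetaValue 3 -
        (coeffV (recTriple n i) : ℝ) := by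
  obtain ⟨h0, hb, hsum⟩ := recTriple_region n hn i
  exact vwpDual_seven_eq_of_region _ h0 hb hsum

/-! ### Brown–Zudilin's gauge `F₇ = (35)·F̃₇` and the coefficient triples (`r = uξ + wη + v`, so `v = −(35)·V`) -/

/-- The arithmetic renormalisation factor of [BrownZudilin2022, (35)] as a rational number:
`(b₀−b₁−b₆)!(b₀−b₁−b₇)!(b₀−b₂−b₇)!(b₀−b₃−b₅)!(b₀−b₄−b₅)!(b₀−b₄−b₆)!/(b₂! b₃!)` (factorials through
`zfact`, as in the Literature definition of `F7`). -/
def bzPref (b : ℕ → ℤ) : ℚ :=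
  ((zfact (b 0 - b 1 - b 6) * zfact (b 0 - b 1 - b 7) * zfact (b 0 - b 2 - b 7) *
      zfact (b 0 - b 3 - b 5) * zfact (b 0 - b 4 - b 5) * zfact (b 0 - b 4 - b 6) : ℕ) : ℚ) /
    ((zfact (b 2) * zfact (b 3) : ℕ) : ℚ)

/-- `F₇(b) = bzPref(b) · F̃₇(b)` (unfolding the Literature definition of `F7`). -/
theorem F7_eq_bzPref_mul (b : ℕ → ℤ) : F7 b = (bzPref b : ℝ) * vwpDual 7 b := by
  simp only [F7, bzPref]
  push_cast
  ring

/-- `u n i = (35)·U(recTriple n i)` (coefficient of `ζ(5)` of the member `F₇(bᵢ)`; an integer by Brown–Zudilin's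
design of (35), a fact not used here). -/
noncomputable def recU (n : ℕ) (i : Fin 3) : ℚ := bzPref (recTriple n i) * coeffU (recTriple n i)

/-- `w n i = (35)·W(recTriple n i)` (coefficient of `ζ(3)` of `F₇(bᵢ)`, the one eliminated). -/
noncomputable def recW (n : ℕ) (i : Fin 3) : ℚ := bzPref (recTriple n i) * coeffW (recTriple n i)

/-- `v n i = −(35)·V(recTriple n i)` (constant term of `F₇(bᵢ)` in the `+`-convention of `LatticeCriterion`). -/
noncomputable def recV (n : ℕ) (i : Fin 3) : ℚ := -(bzPref (recTriple n i) * coeffV (recTriple n i))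

/-- The members' values `F₇(bᵢ)` are the three-term forms of the triples `(recU, recW, recV)` (for `n ≥ 1`). -/
theorem F7_recTriple_eq (n : ℕ) (hn : 1 ≤ n) (i : Fin 3) :
    F7 (recTriple n i) =
      (recU n i : ℝ) * zetaValue 5 + (recW n i : ℝ) * zetaValue 3 + (recV n i : ℝ) := by
  rw [F7_eq_bzPref_mul, recTriple_decomp n hn i]
  simp only [recU, recW, recV]
  push_cast
  ring

/-- The height rate `T = 55` of the hypothesis below: the observed `λ₂`-rate of `M_n` is `51.4 … 53.2` nats per
step for `6 ≤ n ≤ 22` (all three triples, gauge `F₇`, exact), so `e^{55 n}` bounds both successive minima with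
visible slack; see the docstring of `LatticeBalanceRecord` for why SOME explicit height bound is essential and why
the precise value is immaterial in the window `(λ₂-rate, c) ≈ (52.5, 86)`. -/
def heightRate : ℝ := 55

/-! ### The open hypothesis and the reduction -/

/-- **OPEN HYPOTHESIS (lattice balance on the record module, gauge `F₇`, explicit heights).**  For every `q ≥ 1`
there is an index `n ≥ 1` at which (a) the coefficient triple `(u, w, v)` of the three members `F₇(bᵢ)` has rank 3,
and (b) there are two linearly independent integer vectors `α, β ⊥ (w(bᵢ))ᵢ` with `α·u, α·v, β·u, β·v ∈ ℤ` (i.e.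
`α, β ∈ M_n`), OF HEIGHT `maxᵢ |αᵢ|, maxᵢ |βᵢ| ≤ e^{55 n}`, whose eliminated forms `Σᵢ αᵢ F₇(bᵢ)`, `Σᵢ βᵢ F₇(bᵢ)`
are both `< 1/q` in absolute value.  WHY THE HEIGHT BOUND IS ESSENTIAL: the map `α ↦ (α·u, α·v)` embeds `M_n`
as a finite-index sublattice `P_n ⊂ ℤ²` (index `≈ e^{49 n}` on the data), and the eliminated form of `α` is just
`A ζ(5) + B` for its pair `(A, B)`; WITHOUT a height bound, clause (b) therefore follows from `ζ(5) ∉ ℚ` alone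
(scale two independent Dirichlet pairs by the index) — the height-free statement is EQUIVALENT to irrationality
(given rank 3) and carries no information about these lattices.  With the bound it is a statement about the
successive minima of the explicit lattices `M_n`: pulled-back Dirichlet pairs have height `≈ e^{135 n}`, the observed
minima have height `e^{(52 ± 1) n}` (`6 ≤ n ≤ 22`, exact), and any two independent vectors of `M_n` below height
`e^{T n}` with `T < c ≈ 86` have (heuristically, by the trivial bound and the unproved decay rate `c` of `F₇(b_n)`)
automatically decaying forms — so for `T` anywhere in `(52.5, 86)` the hypothesis says the same thing, 'the lattices
`M_n` stay balanced', and `T = 55` (`heightRate`) is that statement with slack.  MEASURED exactly in this gauge for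
`n ≤ 22` (`FAMILY.md` §15.4: rank 3 everywhere; balance `log λ₁ / log λ₂ ≥ 0.992` for `n ≥ 7`; forms of both minima
`≈ e^{−33.5 n}`); other gauges §15.8.  Implied by the balance hypothesis `H(τ*)` of §15.3 (with the decay / covolume
rates); implies `ζ(5) ∉ ℚ` (next theorem, which uses neither the height bound nor balance — that is the point: the
arithmetic content is in the bound, the Diophantine consequence is not); no proof technique known
(arXiv:2109.10136, Remark 1) and none can exist short of proving irrationality first: by
`LatticeSandwich.no_short_relation_of_measure` the weakest form `H(τ*)` already follows from
`Irrational ζ(5) ∧ μ(ζ(5)) < 2.37` (module docstring, STATUS) — the statement is a Diophantine property of `ζ(5)`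
sandwiched between irrationality and an irrationality measure; DOCUMENTATION OF A CLOSED ROAD, never to be staffed.
NOT a claim. -/
@[conjecture] def LatticeBalanceRecord : Prop :=
  ∀ q : ℕ, 0 < q → ∃ n : ℕ, 1 ≤ n ∧
    (∀ a : Fin 3 → ℚ,
      ∑ i, a i * recU n i = 0 → ∑ i, a i * recW n i = 0 → ∑ i, a i * recV n i = 0 → a = 0) ∧
    ∃ α β : Fin 3 → ℤ,
      (∀ i, (|α i| : ℝ) ≤ Real.exp (heightRate * n)) ∧ (∀ i, (|β i| : ℝ) ≤ Real.exp (heightRate * n)) ∧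
      ∑ i, (α i : ℚ) * recW n i = 0 ∧ ∑ i, (β i : ℚ) * recW n i = 0 ∧
      (∀ s t : ℚ, s • (fun i => (α i : ℚ)) = t • (fun i => (β i : ℚ)) → s = 0 ∧ t = 0) ∧
      (∃ A B : ℤ, (A : ℚ) = ∑ i, (α i : ℚ) * recU n i ∧ (B : ℚ) = ∑ i, (α i : ℚ) * recV n i) ∧
      (∃ A B : ℤ, (A : ℚ) = ∑ i, (β i : ℚ) * recU n i ∧ (B : ℚ) = ∑ i, (β i : ℚ) * recV n i) ∧
      |∑ i, (α i : ℝ) * F7 (recTriple n i)| < 1 / (q : ℝ) ∧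
      |∑ i, (β i : ℝ) * F7 (recTriple n i)| < 1 / (q : ℝ)

/-- **THE REDUCTION (conditional; the hypothesis is open).**  Lattice balance on the record module implies the
irrationality of `ζ(5)`: each of the two relations turns the three members `F₇(bᵢ)` into an integer pair
`A ζ(5) + B` smaller than `1/q` (the height bounds are discarded — see the hypothesis' docstring); independence of the pairs comes from rank 3
(`pairs_independent_of_rank_three`); two independent pairs cannot both annihilate `(p, q)`
(`irrational_of_two_independent_small_pairs`). -/
theorem irrational_zetaFive_of_latticeBalanceRecord (h : LatticeBalanceRecord) :
    Irrational (zetaValue 5) := by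
  apply irrational_of_lattice_elimination (zetaValue 5) (zetaValue 3) recU recW recV
  intro q hq
  obtain ⟨n, hn, hrank, α, β, -, -, hαw, hβw, hind, hA, hB, hsα, hsβ⟩ := h q hq
  have hform : ∀ γ : Fin 3 → ℤ,
      ∑ i, (γ i : ℝ) * ((recU n i : ℝ) * zetaValue 5 + (recW n i : ℝ) * zetaValue 3 + (recV n i : ℝ)) =
        ∑ i, (γ i : ℝ) * F7 (recTriple n i) := by
    intro γ
    refine sum_congr rfl fun i _ => ?_
    rw [F7_recTriple_eq n hn i]
  refine ⟨n, hrank, α, β, hαw, hβw, hind, hA, hB, ?_, ?_⟩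
  · rw [hform α]; exact hsα
  · rw [hform β]; exact hsβ

end Summit.KontsevichZagierPeriods.Zeta5Search.Elimination
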